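import Literature.AnabelianGeometry.SemiGraphs.PSCGraphicProofs
import Mathlib.Topology.Algebra.Group.Quotient

/-!
# What group-theoretically cuspidal / edge-like / verticial isomorphisms induce ([CombGC] Def. 1.4, Prop. 1.5 (ii)), proved

Mochizuki, *A combinatorial version of the Grothendieck conjecture*, Tohoku Math. J. **59** (2007)
[CombGC], §1, Definition 1.4 (iv) (p. 11) and the quotients `Π_G ↠ Π^cpt_G ↠ Π^unr_G ↠ Π^grph_G`
of Definition 1.1 (ii) (p. 7).  Over the interface `PSCDatum Π` (`PSCFundamentalGroup.lean`,
`PSCGraphicity.lean`) this proof-only file establishes, for EVERY pair of data and every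
`α : Π_G ≅ Π_H`, the transport facts that §1 uses without comment when it passes from `α` to the
induced isomorphisms of the quotients (e.g. Theorem 1.6 (iii) is stated for `β : Π^unr_G ≅ Π^unr_H`):

* a group-theoretically cuspidal `α` carries `Ker(Π_G ↠ Π^cpt_G)` onto `Ker(Π_H ↠ Π^cpt_H)`; a
  group-theoretically edge-like `α` carries `Ker(↠ Π^unr)` onto `Ker(↠ Π^unr)` and therefore
  INDUCES a topological isomorphism `β : Π^unr_G ≅ Π^unr_H` compatible with the projections; a
  group-theoretically verticial `α` carries `Ker(↠ Π^grph)` onto `Ker(↠ Π^grph)`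
  (`map_cptKer_of_isGroupTheoreticallyCuspidal`, `map_unrKer_of_isGroupTheoreticallyEdgeLike`,
  `exists_unrQuotient_equiv`, `map_grphKer_of_isGroupTheoreticallyVerticial`); in particular all
  of this holds for a graphic `α` (Prop. 1.5 (ii) ⇒, `PSCGraphicProofs.lean`);
  [cite: MochizukiCombGC2007, Def 1.4(iv) p.11]
* Definition 1.4 (i): graphicity is symmetric (`IsGraphic.symm`), and the uniqueness clause of
  Proposition 1.5 (ii) ("`α` arises from a UNIQUE isomorphism of semi-graphs of anabelioids")
  follows formally from Proposition 1.2 (i) for `H` (`graphicVia_unique_of_openInter`) — a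
  reduction of the second conjunct of `GraphicIffEdgeLikeVerticial` to
  `VerticialOpenInterDeterminesVertex` / `EdgeLikeOpenInterDeterminesEdge`.
  [cite: MochizukiCombGC2007, Prop 1.5(ii) p.13]

Pure proofs; no definitions; nothing here takes a side on [IUTchIII] Cor. 3.12.
-/

noncomputable section

namespace Literature.AnabelianGeometry.SemiGraphs

namespace PSCDatum

open scoped Pointwise

universe u

variable {P : Type u} [Group P] [TopologicalSpace P] [IsTopologicalGroup P]
variable {P' : Type u} [Group P'] [TopologicalSpace P'] [IsTopologicalGroup P']

/-! ### Transport of closed normal closures along `α` -/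

section Transport

/-- A topological group isomorphism carries topological closures to topological closures.
[cite: MochizukiCombGC2007, Def 1.4(iv) p.11] -/
theorem map_topologicalClosure (α : P ≃ₜ* P') (S : Subgroup P) :
    S.topologicalClosure.map α.toMulEquiv.toMonoidHom =
      (S.map α.toMulEquiv.toMonoidHom).topologicalClosure := by
  apply SetLike.coe_injective
  simp only [Subgroup.coe_map, Subgroup.topologicalClosure_coe]
  exact α.toHomeomorph.image_closure (S : Set P)

omit [TopologicalSpace P] [IsTopologicalGroup P] [TopologicalSpace P'] [IsTopologicalGroup P'] in
/-- A conjugate of a subgroup contained in `s` lies in the normal closure of `s`.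
[cite: MochizukiCombGC2007, Def 1.1(ii) p.7] -/
theorem smul_le_normalClosure {K : Subgroup P} {s : Set P} (h : (K : Set P) ⊆ s) (γ : ConjAct P) :
    γ • K ≤ Subgroup.normalClosure s := by
  rw [← (Subgroup.normalClosure_normal (s := s)).conjAct γ,
    Subgroup.pointwise_smul_le_pointwise_smul_iff]
  exact fun y hy => Subgroup.subset_normalClosure (h hy)

/-- If `α` maps `s` into the normal closure of `t` and every element of `t` is hit by the normal
closure of `s`, then `α` carries the closed normal subgroup generated by `s` onto the one generated
by `t`. [cite: MochizukiCombGC2007, Def 1.4(iv) p.11] -/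
theorem map_closure_normalClosure_eq (α : P ≃ₜ* P') {s : Set P} {t : Set P'}
    (h₁ : ∀ x ∈ s, α x ∈ Subgroup.normalClosure t)
    (h₂ : ∀ y ∈ t, y ∈ (Subgroup.normalClosure s).map α.toMulEquiv.toMonoidHom) :
    (Subgroup.normalClosure s).topologicalClosure.map α.toMulEquiv.toMonoidHom =
      (Subgroup.normalClosure t).topologicalClosure := by
  rw [map_topologicalClosure]
  congr 1
  haveI : ((Subgroup.normalClosure s).map α.toMulEquiv.toMonoidHom).Normal :=
    (Subgroup.normalClosure_normal (s := s)).map _ α.toMulEquiv.surjective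
  apply le_antisymm
  · rw [Subgroup.map_normalClosure _ _ α.toMulEquiv.surjective]
    refine Subgroup.normalClosure_le_normal ?_
    rintro _ ⟨x, hx, rfl⟩
    exact h₁ x hx
  · exact Subgroup.normalClosure_le_normal fun y hy => h₂ y hy

end Transport

variable {G : PSCDatum P} {H : PSCDatum P'} {α : P ≃ₜ* P'}

/-! ### The kernels of `Π ↠ Π^cpt`, `Π ↠ Π^unr`, `Π ↠ Π^grph` under `α` -/

section Kernels

/-- **A group-theoretically cuspidal `α` induces `Π^cpt_G ≅ Π^cpt_H`**: it carries
`Ker(Π_G ↠ Π^cpt_G)` onto `Ker(Π_H ↠ Π^cpt_H)`. [cite: MochizukiCombGC2007, Def 1.4(iv) p.11] -/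
theorem map_cptKer_of_isGroupTheoreticallyCuspidal (h : G.IsGroupTheoreticallyCuspidal H α) :
    G.cptKer.map α.toMulEquiv.toMonoidHom = H.cptKer := by
  refine map_closure_normalClosure_eq α (fun x hx => ?_) (fun y hy => ?_)
  · obtain ⟨c, hxc⟩ := Set.mem_iUnion.mp hx
    obtain ⟨c', γ, hc'⟩ := h.1 (G.cuspGp c) ⟨c, 1, by rw [one_smul]⟩
    have hmem : α x ∈ (G.cuspGp c).map α.toMulEquiv.toMonoidHom := Subgroup.mem_map_of_mem _ hxc
    rw [hc'] at hmem
    exact smul_le_normalClosure (fun z hz => Set.mem_iUnion.mpr ⟨c', hz⟩) γ hmem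
  · obtain ⟨c', hyc'⟩ := Set.mem_iUnion.mp hy
    obtain ⟨A, ⟨c, γ, rfl⟩, hA⟩ := h.2 (H.cuspGp c') ⟨c', 1, by rw [one_smul]⟩
    rw [← hA] at hyc'
    exact Subgroup.map_mono (smul_le_normalClosure (fun z hz => Set.mem_iUnion.mpr ⟨c, hz⟩) γ) hyc'

/-- **A group-theoretically edge-like `α` induces `Π^unr_G ≅ Π^unr_H`**: it carries
`Ker(Π_G ↠ Π^unr_G)` onto `Ker(Π_H ↠ Π^unr_H)`. [cite: MochizukiCombGC2007, Def 1.4(iv) p.11] -/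
theorem map_unrKer_of_isGroupTheoreticallyEdgeLike (h : G.IsGroupTheoreticallyEdgeLike H α) :
    G.unrKer.map α.toMulEquiv.toMonoidHom = H.unrKer := by
  refine map_closure_normalClosure_eq α (fun x hx => ?_) (fun y hy => ?_)
  · -- `x` lies in a representative edge-like subgroup `E` of `G`
    obtain ⟨E, hE, hxE⟩ : ∃ E, G.IsEdgeLike E ∧ x ∈ E := by
      rcases hx with hx | hx
      · obtain ⟨c, hxc⟩ := Set.mem_iUnion.mp hx
        exact ⟨G.cuspGp c, Or.inr ⟨c, 1, by rw [one_smul]⟩, hxc⟩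
      · obtain ⟨e, hxe⟩ := Set.mem_iUnion.mp hx
        exact ⟨G.nodeGp e, Or.inl ⟨e, 1, by rw [one_smul]⟩, hxe⟩
    have hmem : α x ∈ E.map α.toMulEquiv.toMonoidHom := Subgroup.mem_map_of_mem _ hxE
    rcases h.1 E hE with ⟨e', γ, hE'⟩ | ⟨c', γ, hE'⟩
    · rw [hE'] at hmem
      exact smul_le_normalClosure (fun z hz => Or.inr (Set.mem_iUnion.mpr ⟨e', hz⟩)) γ hmem
    · rw [hE'] at hmem
      exact smul_le_normalClosure (fun z hz => Or.inl (Set.mem_iUnion.mpr ⟨c', hz⟩)) γ hmem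
  · -- `y` lies in a representative edge-like subgroup of `H`, which arises from `G`
    obtain ⟨B, hB, hyB⟩ : ∃ B, H.IsEdgeLike B ∧ y ∈ B := by
      rcases hy with hy | hy
      · obtain ⟨c', hyc'⟩ := Set.mem_iUnion.mp hy
        exact ⟨H.cuspGp c', Or.inr ⟨c', 1, by rw [one_smul]⟩, hyc'⟩
      · obtain ⟨e', hye'⟩ := Set.mem_iUnion.mp hy
        exact ⟨H.nodeGp e', Or.inl ⟨e', 1, by rw [one_smul]⟩, hye'⟩
    obtain ⟨A, hA, hAB⟩ := h.2 B hB
    rw [← hAB] at hyB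
    refine Subgroup.map_mono ?_ hyB
    rcases hA with ⟨e, γ, rfl⟩ | ⟨c, γ, rfl⟩
    · exact smul_le_normalClosure (fun z hz => Or.inr (Set.mem_iUnion.mpr ⟨e, hz⟩)) γ
    · exact smul_le_normalClosure (fun z hz => Or.inl (Set.mem_iUnion.mpr ⟨c, hz⟩)) γ

/-- **A group-theoretically verticial `α` induces `Π^grph_G ≅ Π^grph_H`**: it carries
`Ker(Π_G ↠ Π^grph_G)` onto `Ker(Π_H ↠ Π^grph_H)`. [cite: MochizukiCombGC2007, Def 1.4(iv) p.11] -/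
theorem map_grphKer_of_isGroupTheoreticallyVerticial (h : G.IsGroupTheoreticallyVerticial H α) :
    G.grphKer.map α.toMulEquiv.toMonoidHom = H.grphKer := by
  refine map_closure_normalClosure_eq α (fun x hx => ?_) (fun y hy => ?_)
  · obtain ⟨v, hxv⟩ := Set.mem_iUnion.mp hx
    obtain ⟨w, γ, hw⟩ := h.1 (G.vertGp v) ⟨v, 1, by rw [one_smul]⟩
    have hmem : α x ∈ (G.vertGp v).map α.toMulEquiv.toMonoidHom := Subgroup.mem_map_of_mem _ hxv
    rw [hw] at hmem
    exact smul_le_normalClosure (fun z hz => Set.mem_iUnion.mpr ⟨w, hz⟩) γ hmem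
  · obtain ⟨w, hyw⟩ := Set.mem_iUnion.mp hy
    obtain ⟨A, ⟨v, γ, rfl⟩, hA⟩ := h.2 (H.vertGp w) ⟨w, 1, by rw [one_smul]⟩
    rw [← hA] at hyw
    exact Subgroup.map_mono (smul_le_normalClosure (fun z hz => Set.mem_iUnion.mpr ⟨v, hz⟩) γ) hyw

/-- **The isomorphism `β : Π^unr_G ≅ Π^unr_H` induced by `α`**: whenever `α` carries
`Ker(Π_G ↠ Π^unr_G)` onto `Ker(Π_H ↠ Π^unr_H)` (e.g. `α` group-theoretically edge-like, or graphic),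
there is a topological group isomorphism of the unramified quotients compatible with the
projections. [cite: MochizukiCombGC2007, Def 1.4(iii) p.10] -/
theorem exists_unrQuotient_equiv (hα : G.unrKer.map α.toMulEquiv.toMonoidHom = H.unrKer) :
    ∃ β : (P ⧸ G.unrKer) ≃ₜ* (P' ⧸ H.unrKer),
      ∀ x : P, β (QuotientGroup.mk x) = QuotientGroup.mk (α x) := by
  let e : P ⧸ G.unrKer ≃* P' ⧸ H.unrKer := QuotientGroup.congr G.unrKer H.unrKer α.toMulEquiv hα
  have he : ∀ x : P, e (QuotientGroup.mk x) = QuotientGroup.mk (α x) := fun x => rfl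
  have he' : ∀ y : P', e.symm (QuotientGroup.mk y) = QuotientGroup.mk (α.symm y) := fun y => rfl
  have hcont : Continuous e := by
    rw [(QuotientGroup.isQuotientMap_mk G.unrKer).continuous_iff]
    have : (e : P ⧸ G.unrKer → P' ⧸ H.unrKer) ∘ QuotientGroup.mk = QuotientGroup.mk ∘ α :=
      funext he
    rw [this]
    exact QuotientGroup.continuous_mk.comp α.continuous
  have hcont' : Continuous e.symm := by
    rw [(QuotientGroup.isQuotientMap_mk H.unrKer).continuous_iff]
    have : (e.symm : P' ⧸ H.unrKer → P ⧸ G.unrKer) ∘ QuotientGroup.mk = QuotientGroup.mk ∘ α.symm :=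
      funext he'
    rw [this]
    exact QuotientGroup.continuous_mk.comp α.symm.continuous
  exact ⟨{ e with continuous_toFun := hcont, continuous_invFun := hcont' }, he⟩

/-- A group-theoretically edge-like `α` induces `β : Π^unr_G ≅ Π^unr_H` over the projections.
[cite: MochizukiCombGC2007, Def 1.4(iv) p.11] -/
theorem IsGroupTheoreticallyEdgeLike.exists_unrQuotient_equiv
    (h : G.IsGroupTheoreticallyEdgeLike H α) :
    ∃ β : (P ⧸ G.unrKer) ≃ₜ* (P' ⧸ H.unrKer),
      ∀ x : P, β (QuotientGroup.mk x) = QuotientGroup.mk (α x) :=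
  PSCDatum.exists_unrQuotient_equiv (map_unrKer_of_isGroupTheoreticallyEdgeLike h)

/-- A graphic `α` carries all three kernels onto the corresponding kernels and induces
`β : Π^unr_G ≅ Π^unr_H`. [cite: MochizukiCombGC2007, Prop 1.5(ii) p.13] -/
theorem IsGraphic.map_kernels (h : G.IsGraphic H α) :
    G.cptKer.map α.toMulEquiv.toMonoidHom = H.cptKer ∧
      G.unrKer.map α.toMulEquiv.toMonoidHom = H.unrKer ∧
      G.grphKer.map α.toMulEquiv.toMonoidHom = H.grphKer ∧
      ∃ β : (P ⧸ G.unrKer) ≃ₜ* (P' ⧸ H.unrKer),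
        ∀ x : P, β (QuotientGroup.mk x) = QuotientGroup.mk (α x) :=
  ⟨map_cptKer_of_isGroupTheoreticallyCuspidal h.isGroupTheoreticallyCuspidal,
    map_unrKer_of_isGroupTheoreticallyEdgeLike h.isGroupTheoreticallyEdgeLike_and_verticial.1,
    map_grphKer_of_isGroupTheoreticallyVerticial h.isGroupTheoreticallyEdgeLike_and_verticial.2,
    h.isGroupTheoreticallyEdgeLike_and_verticial.1.exists_unrQuotient_equiv⟩

end Kernels

/-! ### Definition 1.4 (i): symmetry of graphicity; Prop. 1.5 (ii): uniqueness of `ι` from Prop. 1.2 (i) -/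

section Graphic

omit [IsTopologicalGroup P] [IsTopologicalGroup P'] in
/-- Transport back along `α`: if `α(S) = γ T` then `α⁻¹(T) = α⁻¹(γ⁻¹) S`.
[cite: MochizukiCombGC2007, Def 1.4(i) p.10] -/
theorem map_symm_eq_smul {S : Subgroup P} {T : Subgroup P'} {γ : ConjAct P'}
    (h : S.map α.toMulEquiv.toMonoidHom = γ • T) :
    T.map α.symm.toMulEquiv.toMonoidHom =
      ConjAct.toConjAct (α.symm (ConjAct.ofConjAct γ⁻¹)) • S := by
  have hT : T = γ⁻¹ • S.map α.toMulEquiv.toMonoidHom := by rw [h, inv_smul_smul]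
  have hback : (S.map α.toMulEquiv.toMonoidHom).map α.symm.toMulEquiv.toMonoidHom = S := by
    rw [Subgroup.map_map]
    convert Subgroup.map_id S
    ext x
    exact α.symm_apply_apply x
  rw [hT, map_conj_smul, hback]
  rfl

omit [IsTopologicalGroup P] [IsTopologicalGroup P'] in
/-- **Graphicity is symmetric** (Def. 1.4 (i)): if `α` is graphic via `ι`, then `α⁻¹` is graphic
via `ι⁻¹`. [cite: MochizukiCombGC2007, Def 1.4(i) p.10] -/
theorem IsGraphic.symm (h : G.IsGraphic H α) : H.IsGraphic G α.symm := by
  obtain ⟨ι, hv, hn, hc⟩ := h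
  refine ⟨⟨ι.vertEquiv.symm, ι.nodeEquiv.symm, ι.cuspEquiv.symm, fun e => ?_, fun c => ?_⟩,
    fun w => ?_, fun e => ?_, fun c => ?_⟩
  · apply_fun Sym2.map ι.vertEquiv using Sym2.map.injective ι.vertEquiv.injective
    rw [← ι.nodeEnds_comm, Equiv.apply_symm_apply, Sym2.map_map, Equiv.self_comp_symm, Sym2.map_id]
    rfl
  · apply ι.vertEquiv.injective
    rw [← ι.cuspEnd_comm, Equiv.apply_symm_apply, Equiv.apply_symm_apply]
  · obtain ⟨γ, hγ⟩ := hv (ι.vertEquiv.symm w)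
    rw [Equiv.apply_symm_apply] at hγ
    exact ⟨_, map_symm_eq_smul hγ⟩
  · obtain ⟨γ, hγ⟩ := hn (ι.nodeEquiv.symm e)
    rw [Equiv.apply_symm_apply] at hγ
    exact ⟨_, map_symm_eq_smul hγ⟩
  · obtain ⟨γ, hγ⟩ := hc (ι.cuspEquiv.symm c)
    rw [Equiv.apply_symm_apply] at hγ
    exact ⟨_, map_symm_eq_smul hγ⟩

omit [IsTopologicalGroup P'] in
/-- Conjugate representative subgroups have an open (indeed total) mutual intersection: the
hypothesis shape of Prop. 1.2 (i). [cite: MochizukiCombGC2007, Prop 1.2(i) p.8] -/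
theorem isOpen_subgroupOf_inf_of_eq {A B : Subgroup P'} (h : A = B) :
    IsOpen (((A ⊓ B).subgroupOf A : Subgroup A) : Set A) := by
  subst h
  rw [inf_idem, Subgroup.subgroupOf_self, Subgroup.coe_top]
  exact isOpen_univ

omit [IsTopologicalGroup P] [IsTopologicalGroup P'] in
/-- **[CombGC] Prop. 1.5 (ii), uniqueness clause, from Prop. 1.2 (i)**: if distinct vertices
(resp. edges) of `H` have representative subgroups with non-open mutual intersections — the
conclusions `VerticialOpenInterDeterminesVertex`, `EdgeLikeOpenInterDeterminesEdge` of Prop. 1.2 (i)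
for `H` — then the isomorphism of underlying semi-graphs through which `α` is graphic is unique.
[cite: MochizukiCombGC2007, Prop 1.5(ii) p.13] -/
theorem graphicVia_unique_of_openInter (hV : H.VerticialOpenInterDeterminesVertex)
    (hE : H.EdgeLikeOpenInterDeterminesEdge) {ι ι' : PSCSemiGraph.Iso G.graph H.graph}
    (h : G.IsGraphicVia H α ι) (h' : G.IsGraphicVia H α ι') :
    ι.vertEquiv = ι'.vertEquiv ∧ ι.nodeEquiv = ι'.nodeEquiv ∧ ι.cuspEquiv = ι'.cuspEquiv := by
  obtain ⟨hv, hn, hc⟩ := h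
  obtain ⟨hv', hn', hc'⟩ := h'
  refine ⟨Equiv.ext fun v => ?_, Equiv.ext fun e => ?_, Equiv.ext fun c => ?_⟩
  · obtain ⟨γ, hγ⟩ := hv v
    obtain ⟨γ', hγ'⟩ := hv' v
    exact hV _ _ γ γ' (isOpen_subgroupOf_inf_of_eq (hγ.symm.trans hγ'))
  · obtain ⟨γ, hγ⟩ := hn e
    obtain ⟨γ', hγ'⟩ := hn' e
    have := hE (Sum.inl (ι.nodeEquiv e)) (Sum.inl (ι'.nodeEquiv e)) γ γ'
      (isOpen_subgroupOf_inf_of_eq (hγ.symm.trans hγ'))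
    exact Sum.inl_injective this
  · obtain ⟨γ, hγ⟩ := hc c
    obtain ⟨γ', hγ'⟩ := hc' c
    have := hE (Sum.inr (ι.cuspEquiv c)) (Sum.inr (ι'.cuspEquiv c)) γ γ'
      (isOpen_subgroupOf_inf_of_eq (hγ.symm.trans hγ'))
    exact Sum.inr_injective this

omit [IsTopologicalGroup P] [IsTopologicalGroup P'] in
/-- Hence the second conjunct of `GraphicIffEdgeLikeVerticial G H α` (uniqueness of the
isomorphism of semi-graphs) follows from Prop. 1.2 (i) for `H`.
[cite: MochizukiCombGC2007, Prop 1.5(ii) p.13] -/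
theorem graphicIffEdgeLikeVerticial_unique_of_openInter (hV : H.VerticialOpenInterDeterminesVertex)
    (hE : H.EdgeLikeOpenInterDeterminesEdge) :
    ∀ ι ι' : PSCSemiGraph.Iso G.graph H.graph, G.IsGraphicVia H α ι → G.IsGraphicVia H α ι' →
      ι.vertEquiv = ι'.vertEquiv ∧ ι.nodeEquiv = ι'.nodeEquiv ∧ ι.cuspEquiv = ι'.cuspEquiv :=
  fun _ _ h h' => graphicVia_unique_of_openInter hV hE h h'

end Graphic

end PSCDatum

end Literature.AnabelianGeometry.SemiGraphs

end
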